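import Literature.AlgebraicGeometry.Resolution.Lipman1969NegativeDefinite
import HarnessLib

/-!
# Crux `NoZenoR` (stmt-ResolutionOfSingularities-19943), facts slot `Lipman1969_14_1`: the LINEAR ALGEBRA of
# du Val's lemma — a symmetric matrix with non-negative off-diagonal entries and a positive vector with
# non-positive row sums, no sub-family of which is "closed", is negative definite

Route `ResolutionOfSingularities/HomologicalConductor` (cell decomp-res, hand leafhand-res-homologicalconduct-9 g0).
OURS: AI-written bookkeeping, weaker than expert review; nothing here is a statement of the manuscript under review
(Hironaka 2017).  SUPPORT level, counted 0.  Def-free, FACT-FREE, Mathlib-only content.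

This is the matrix half of Lipman 1969, Lemma (14.1) (negative definiteness of the intersection matrix
`((E_i·E_j))` of the exceptional curves of a desingularization of a two-dimensional normal local ring; du Val,
Mumford).  The geometric half supplies, for a finite family `F` of integral exceptional curves and
`0 ≠ f ∈ 𝔪`: `e·div(π^*f) ∼ D' + Σ_j a_j [E_j]` with `a_j > 0`, `D'` effective avoiding the `η_j`, whence the
ROW RELATIONS `Σ_j a_j (E_j·E_i) = −(D'·E_i) ≤ 0`, and — by Zariski connectedness of the closed fibre and
Krull's principal ideal theorem, as in `…NoZenoSelfIntersectionStrict` — for every non-empty sub-family `C ⊆ F`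
some `i ∈ C` with `Σ_{j ∈ C} a_j (E_j·E_i) ≠ 0`.  From these and the SYMMETRY `(E_i·E_j) = (E_j·E_i)` and
`(E_i·E_j) ≥ 0` (`i ≠ j`) the present file concludes `Σ_i Σ_j y_i y_j (E_j·E_i) < 0` for every `y ≠ 0`:

* `quadForm_neg_of_symm_of_rowSum_nonpos` — over a linearly ordered field;
* `quadForm_neg_of_symm_of_rowSum_nonpos_int` — the `ℤ`-valued version in the binder shape of `Lipman1969_14_1`.

Proof: with `z_i = y_i / a_i`, `2·Σ_{i,j} y_i y_j M_{ji} = 2·Σ_i z_i² a_i (Σ_j a_j M_{ji}) − Σ_{i,j} a_i a_j M_{ji} (z_i − z_j)²`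
(this uses the symmetry), both parts `≤ 0`; if the total vanishes every term vanishes, so on the support `C` of `z`
all row sums vanish and `M_{ji} = 0` for `j ∉ C`, `i ∈ C`, i.e. `Σ_{j ∈ C} a_j M_{ji} = 0` on `C` — excluded.

References: J. Lipman, *Rational singularities …*, Publ. Math. IHÉS 36 (1969), Lemma (14.1) p. 224 [`Lipman1969`];
D. Mumford, Publ. Math. IHÉS 9 (1961) 5–22, p. 6 (the negative definiteness argument).
-/

-- single-problem summit: the doubled namespace component `ResolutionOfSingularities` is forced
set_option linter.dupNamespace false

namespace Summit.ResolutionOfSingularities.ResolutionOfSingularities.Theorems.NoZeno.ExcCount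

open Finset

/-- **du Val's lemma, matrix form (over an ordered field).**  Let `M` be a symmetric `ι × ι` matrix with
non-negative off-diagonal entries, `a` a vector with positive entries such that every row sum `Σ_j a_j M_{ji}` is
`≤ 0`, and suppose that for every non-empty `C ⊆ ι` some `i ∈ C` has `Σ_{j ∈ C} a_j M_{ji} ≠ 0`.  Then the quadratic
form of `M` is negative definite: `Σ_i Σ_j y_i y_j M_{ji} < 0` for `y ≠ 0`.
[cite: Lipman1969, Lemma (14.1) (p. 224)] -/
theorem quadForm_neg_of_symm_of_rowSum_nonpos {ι K : Type*} [Fintype ι] [DecidableEq ι] [Field K]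
    [LinearOrder K] [IsStrictOrderedRing K] {M : ι → ι → K} (hsymm : ∀ i j, M i j = M j i)
    (hoff : ∀ i j, i ≠ j → 0 ≤ M i j) {a : ι → K} (ha : ∀ i, 0 < a i)
    (hrow : ∀ i, ∑ j, a j * M j i ≤ 0)
    (hC : ∀ C : Finset ι, C.Nonempty → ∃ i ∈ C, ∑ j ∈ C, a j * M j i ≠ 0)
    {y : ι → K} (hy : y ≠ 0) :
    ∑ i, ∑ j, y i * y j * M j i < 0 := by
  -- rescale: `y_i = a_i z_i`
  obtain ⟨z, rfl⟩ : ∃ z : ι → K, y = fun i => a i * z i :=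
    ⟨fun i => y i / a i, funext fun i => (mul_div_cancel₀ (y i) (ha i).ne').symm⟩
  have hz : z ≠ 0 := by
    rintro rfl
    exact hy (funext fun i => by simp)
  -- the row sums
  let r : ι → K := fun i => ∑ j, a j * M j i
  have hr : ∀ i, r i ≤ 0 := hrow
  -- the identity `2 S = 2 A - B`
  have h1 : ∑ i, ∑ j, a i * a j * M j i * z j ^ 2 = ∑ i, ∑ j, a i * a j * M j i * z i ^ 2 := by
    rw [Finset.sum_comm]
    refine Finset.sum_congr rfl fun i _ => Finset.sum_congr rfl fun j _ => ?_
    rw [hsymm i j]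
    ring
  have hS : ∑ i, ∑ j, (a i * z i) * (a j * z j) * M j i = ∑ i, ∑ j, a i * a j * M j i * (z i * z j) :=
    Finset.sum_congr rfl fun i _ => Finset.sum_congr rfl fun j _ => by ring
  have hA : ∑ i, z i ^ 2 * a i * r i = ∑ i, ∑ j, a i * a j * M j i * z i ^ 2 := by
    refine Finset.sum_congr rfl fun i _ => ?_
    simp only [r, Finset.mul_sum]
    exact Finset.sum_congr rfl fun j _ => by ring
  have hB : ∑ i, ∑ j, a i * a j * M j i * (z i - z j) ^ 2 =
      ∑ i, ∑ j, a i * a j * M j i * z i ^ 2 + ∑ i, ∑ j, a i * a j * M j i * z j ^ 2 -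
        2 * ∑ i, ∑ j, a i * a j * M j i * (z i * z j) := by
    rw [Finset.mul_sum, ← Finset.sum_add_distrib, ← Finset.sum_sub_distrib]
    refine Finset.sum_congr rfl fun i _ => ?_
    rw [Finset.mul_sum, ← Finset.sum_add_distrib, ← Finset.sum_sub_distrib]
    exact Finset.sum_congr rfl fun j _ => by ring
  have hid : 2 * ∑ i, ∑ j, (a i * z i) * (a j * z j) * M j i =
      2 * ∑ i, z i ^ 2 * a i * r i - ∑ i, ∑ j, a i * a j * M j i * (z i - z j) ^ 2 := by
    rw [hB, h1, hA, hS]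
    ring
  -- signs of the two parts
  have hAterm : ∀ i, z i ^ 2 * a i * r i ≤ 0 := fun i =>
    mul_nonpos_of_nonneg_of_nonpos (mul_nonneg (sq_nonneg _) (ha i).le) (hr i)
  have hBterm : ∀ i j, 0 ≤ a i * a j * M j i * (z i - z j) ^ 2 := fun i j => by
    by_cases hij : i = j
    · subst hij
      simp
    · exact mul_nonneg (mul_nonneg (mul_nonneg (ha i).le (ha j).le) (hoff j i (Ne.symm hij)))
        (sq_nonneg _)
  have hAle : ∑ i, z i ^ 2 * a i * r i ≤ 0 := Finset.sum_nonpos fun i _ => hAterm i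
  have hBge : 0 ≤ ∑ i, ∑ j, a i * a j * M j i * (z i - z j) ^ 2 :=
    Finset.sum_nonneg fun i _ => Finset.sum_nonneg fun j _ => hBterm i j
  -- if the form were not negative it would vanish, and then termwise
  by_contra hnot
  have hA0 : ∑ i, z i ^ 2 * a i * r i = 0 := by linarith [not_lt.mp hnot]
  have hB0 : ∑ i, ∑ j, a i * a j * M j i * (z i - z j) ^ 2 = 0 := by linarith [not_lt.mp hnot]
  have hT1 : ∀ i, z i ^ 2 * a i * r i = 0 := fun i =>
    (Finset.sum_eq_zero_iff_of_nonpos fun i _ => hAterm i).mp hA0 i (Finset.mem_univ i)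
  have hT2 : ∀ i j, a i * a j * M j i * (z i - z j) ^ 2 = 0 := fun i j =>
    (Finset.sum_eq_zero_iff_of_nonneg fun j _ => hBterm i j).mp
      ((Finset.sum_eq_zero_iff_of_nonneg fun i _ => Finset.sum_nonneg fun j _ => hBterm i j).mp hB0 i
        (Finset.mem_univ i)) j (Finset.mem_univ j)
  -- the support of `z` is a non-empty family on which the restricted row sums vanish
  set C : Finset ι := Finset.univ.filter fun i => z i ≠ 0 with hCdef
  have hCne : C.Nonempty := by
    obtain ⟨i, hi⟩ := Function.ne_iff.mp hz
    exact ⟨i, Finset.mem_filter.mpr ⟨Finset.mem_univ i, hi⟩⟩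
  obtain ⟨i, hiC, hne⟩ := hC C hCne
  apply hne
  have hzi : z i ≠ 0 := (Finset.mem_filter.mp hiC).2
  have hri : r i = 0 := by
    rcases mul_eq_zero.mp (hT1 i) with h | h
    · exact absurd h (mul_ne_zero (pow_ne_zero 2 hzi) (ha i).ne')
    · exact h
  have hout : ∀ j, j ∉ C → a j * M j i = 0 := by
    intro j hj
    have hzj : z j = 0 := by
      by_contra h
      exact hj (Finset.mem_filter.mpr ⟨Finset.mem_univ j, h⟩)
    have h2 := hT2 i j
    rw [hzj, sub_zero] at h2
    rcases mul_eq_zero.mp h2 with h | h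
    · rcases mul_eq_zero.mp h with h' | h'
      · exact absurd h' (mul_ne_zero (ha i).ne' (ha j).ne')
      · rw [h', mul_zero]
    · exact absurd h (pow_ne_zero 2 hzi)
  rw [Finset.sum_subset (Finset.subset_univ C) fun j _ hj => hout j hj]
  exact hri

/-- **du Val's lemma, matrix form, `ℤ`-valued** (the binder shape of `Lipman1969_14_1`): for a symmetric integer
matrix `M` on a finite index type with `M_{ij} ≥ 0` (`i ≠ j`), a positive integer vector `a` with
`Σ_j a_j M_{ji} ≤ 0` for all `i`, such that every non-empty `C` contains an `i` with `Σ_{j ∈ C} a_j M_{ji} ≠ 0`, and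
every non-zero `y : ι → ℤ`: `Σ_i Σ_j y_i y_j M_{ji} < 0`. [cite: Lipman1969, Lemma (14.1) (p. 224)] -/
theorem quadForm_neg_of_symm_of_rowSum_nonpos_int {ι : Type*} [Fintype ι] [DecidableEq ι] {M : ι → ι → ℤ}
    (hsymm : ∀ i j, M i j = M j i) (hoff : ∀ i j, i ≠ j → 0 ≤ M i j) {a : ι → ℤ} (ha : ∀ i, 0 < a i)
    (hrow : ∀ i, ∑ j, a j * M j i ≤ 0)
    (hC : ∀ C : Finset ι, C.Nonempty → ∃ i ∈ C, ∑ j ∈ C, a j * M j i ≠ 0)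
    {y : ι → ℤ} (hy : y ≠ 0) :
    ∑ i, ∑ j, y i * y j * M j i < 0 := by
  have hy' : (fun i => (y i : ℚ)) ≠ 0 := by
    obtain ⟨i, hi⟩ := Function.ne_iff.mp hy
    refine Function.ne_iff.mpr ⟨i, ?_⟩
    have hi' : y i ≠ 0 := by simpa using hi
    simpa using hi'
  have h := quadForm_neg_of_symm_of_rowSum_nonpos (K := ℚ) (M := fun i j => (M i j : ℚ))
    (fun i j => by exact_mod_cast hsymm i j) (fun i j hij => by exact_mod_cast hoff i j hij)
    (a := fun i => (a i : ℚ)) (fun i => by exact_mod_cast ha i)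
    (fun i => by exact_mod_cast hrow i)
    (fun C hCne => by
      obtain ⟨i, hi, hne⟩ := hC C hCne
      exact ⟨i, hi, by exact_mod_cast hne⟩) hy'
  exact_mod_cast h

end Summit.ResolutionOfSingularities.ResolutionOfSingularities.Theorems.NoZeno.ExcCount
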